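import Summits.Parity.GeneralizedHardyLittlewood.Theorems.LiouvilleShiftedTablesElliottHalberstamLiftingLever
import Literature.NumberTheory.LFunctions.KloostermanFractionsAmplifier

/-!
# `ElliottHalberstam` (stmt-Parity-14092): level lifting, III — the factorable normal form `EH ↔ EHFactorable`

Support lemmas for the crux `LiouvilleShiftedTables.ElliottHalberstam` (= `LiouvilleMAD.ElliottHalberstam` =
`Literature.NumberTheory.Sieve.LevelOfDistribution.ElliottHalberstam`, by `rfl`), line `LiftProof`
(card `smooth-cofactor-lifting`, ideator 2; from the kernel-checked work file `Cruxes/ElliottHalberstam/LiftingProved.lean`).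

* `auxPrimes K` (primes in `(K, 2K]`), `liftedModuli Q K` (moduli `≤ 2QK` with a prime factor in `(K, 2K]`),
  `sum_primeAPError_le_lift` — the pointwise lever `primeAPError_le_lift` AVERAGED over the auxiliary primes:
  `Σ_{q ≤ Q} E*(x;q) ≤ (2K/#auxPrimes K) · B · Σ_{r ∈ liftedModuli Q K} E*(x;r) + Q log x`.
* `factorableModuli x θ ε κ`, `PrimesHaveLevelFactorable θ κ` — the EH shape at level `x^{θ−ε}` restricted to moduli
  carrying a divisor in `(x^κ, 2x^κ]`; `primesHaveLevel_of_factorable` — LEVEL LIFTING, factorable form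
  (inputs: the averaged lever, the PNT lower bound `DFI_card_primes_Ioc_ge : #{K < p ≤ 2K} ≥ K/(2 log K)`, and
  `rpow_mul_log_le_div_eventually`).
* `EHFactorable` and `elliottHalberstam_iff_ehFactorable : ElliottHalberstam ↔ EHFactorable` — the crux is
  EQUIVALENT to its restriction to moduli carrying a divisor of every prescribed power size: a NORMAL FORM of the
  Elliott–Halberstam conjecture (prime moduli are no obstruction; the inert cofactor is untouched). Nothing here
  asserts the crux.
-/

namespace Summit.Parity.GeneralizedHardyLittlewood.Theorems.ElliottHalberstam.Lifting

open scoped BigOperators Classical ArithmeticFunction.vonMangoldt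
open Filter Finset Real
open Literature.NumberTheory.Sieve (primeAPError primeAPError_nonneg abs_sub_le_primeAPError PrimesHaveLevel
  rpow_mul_log_le_div_eventually)
open Literature.NumberTheory.Sieve.LevelOfDistribution (chebyshevPsiMod)

/-! ### The factorable normal form (N1): averaging the lever over auxiliary PRIMES `ℓ ∈ (K, 2K]` -/

/-- Auxiliary primes `ℓ ∈ (K, 2K]`. -/
def auxPrimes (K : ℕ) : Finset ℕ := (Ioc K (2 * K)).filter Nat.Prime

/-- Moduli `r ≤ 2QK` carrying an auxiliary prime factor `ℓ ∈ (K, 2K]`. -/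
def liftedModuli (Q K : ℕ) : Finset ℕ :=
  (Icc 1 (2 * Q * K)).filter (fun r => ∃ ℓ ∈ auxPrimes K, ℓ ∣ r)

/-- Membership in `auxPrimes K`: `K < ℓ ≤ 2K` and `ℓ` prime. -/
theorem mem_auxPrimes {K ℓ : ℕ} : ℓ ∈ auxPrimes K ↔ (K < ℓ ∧ ℓ ≤ 2 * K) ∧ ℓ.Prime := by
  rw [auxPrimes, Finset.mem_filter, Finset.mem_Ioc]

/-- Membership in `liftedModuli Q K`: `1 ≤ r ≤ 2QK` and some `ℓ ∈ auxPrimes K` divides `r`. -/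
theorem mem_liftedModuli {Q K r : ℕ} :
    r ∈ liftedModuli Q K ↔ (1 ≤ r ∧ r ≤ 2 * Q * K) ∧ ∃ ℓ ∈ auxPrimes K, ℓ ∣ r := by
  rw [liftedModuli, Finset.mem_filter, Finset.mem_Icc]

/-- AVERAGED LIFTING (finite form, PROVED). If `auxPrimes K` is nonempty and every lifted modulus has
at most `B` prime divisors in `(K, 2K]`, then
`Σ_{q ≤ Q} E*(x;q) ≤ (2K/#auxPrimes K) · B · Σ_{r ∈ liftedModuli Q K} E*(x;r) + Q · log x`. -/
theorem sum_primeAPError_le_lift (Q K : ℕ) {x : ℝ} (hx : 1 ≤ x) (hP : 0 < #(auxPrimes K)) {B : ℝ}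
    (hB : ∀ r ∈ liftedModuli Q K, (#((auxPrimes K).filter (fun ℓ => ℓ ∣ r)) : ℝ) ≤ B) :
    ∑ q ∈ Icc 1 Q, primeAPError x q ≤
      (2 * K : ℝ) / (#(auxPrimes K) : ℝ) * B * ∑ r ∈ liftedModuli Q K, primeAPError x r
        + Q * Real.log x := by
  have hP' : (0 : ℝ) < (#(auxPrimes K) : ℝ) := by exact_mod_cast hP
  have hlog0 : 0 ≤ Real.log x := Real.log_nonneg hx
  have hE0 : ∀ r, 0 ≤ primeAPError x r := fun r => primeAPError_nonneg x r
  have hprime : ∀ ℓ ∈ auxPrimes K, ℓ.Prime := fun ℓ hℓ => (mem_auxPrimes.mp hℓ).2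
  have hbd : ∀ ℓ ∈ auxPrimes K, K < ℓ ∧ ℓ ≤ 2 * K := fun ℓ hℓ => (mem_auxPrimes.mp hℓ).1
  -- step 1: for each q, average the pointwise lever over ℓ
  have step1 : ∀ q ∈ Icc 1 Q, primeAPError x q ≤
      (2 * K : ℝ) / (#(auxPrimes K) : ℝ) * ∑ ℓ ∈ auxPrimes K, primeAPError x (q * ℓ)
        + Real.log x := by
    intro q hq
    rw [Finset.mem_Icc] at hq
    have hq0 : q ≠ 0 := by omega
    haveI : NeZero q := ⟨hq0⟩
    have hsum : ∑ ℓ ∈ auxPrimes K, primeAPError x q ≤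
        ∑ ℓ ∈ auxPrimes K, ((2 * K : ℝ) * primeAPError x (q * ℓ) + Real.log x) := by
      refine Finset.sum_le_sum fun ℓ hℓ => ?_
      have hℓp := hprime ℓ hℓ
      have hℓ0 : ℓ ≠ 0 := hℓp.ne_zero
      haveI : NeZero (q * ℓ) := ⟨mul_ne_zero hq0 hℓ0⟩
      refine (primeAPError_le_lift hq0 hℓ0 hx).trans (add_le_add ?_ ?_)
      · refine mul_le_mul_of_nonneg_right (totient_ratio_le.trans ?_) (hE0 _)
        exact_mod_cast (hbd ℓ hℓ).2
      · rw [hℓp.primeFactors, Finset.card_singleton, Nat.cast_one, one_mul]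
    rw [Finset.sum_const, nsmul_eq_mul, Finset.sum_add_distrib, ← Finset.mul_sum, Finset.sum_const,
      nsmul_eq_mul] at hsum
    -- hsum : P * E*(q) ≤ 2K * Σ + P * log x
    have key : primeAPError x q * (#(auxPrimes K) : ℝ) ≤
        (2 * K : ℝ) * ∑ ℓ ∈ auxPrimes K, primeAPError x (q * ℓ)
          + Real.log x * (#(auxPrimes K) : ℝ) := by nlinarith [hsum]
    calc primeAPError x q
        = (primeAPError x q * (#(auxPrimes K) : ℝ)) / (#(auxPrimes K) : ℝ) := by field_simp
      _ ≤ ((2 * K : ℝ) * ∑ ℓ ∈ auxPrimes K, primeAPError x (q * ℓ)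
            + Real.log x * (#(auxPrimes K) : ℝ)) / (#(auxPrimes K) : ℝ) :=
          div_le_div_of_nonneg_right key hP'.le
      _ = (2 * K : ℝ) / (#(auxPrimes K) : ℝ) * ∑ ℓ ∈ auxPrimes K, primeAPError x (q * ℓ)
            + Real.log x := by
          field_simp
  -- step 2: sum over q
  have step2 : ∑ q ∈ Icc 1 Q, primeAPError x q ≤
      (2 * K : ℝ) / (#(auxPrimes K) : ℝ) *
          ∑ q ∈ Icc 1 Q, ∑ ℓ ∈ auxPrimes K, primeAPError x (q * ℓ)
        + Q * Real.log x := by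
    calc ∑ q ∈ Icc 1 Q, primeAPError x q
        ≤ ∑ q ∈ Icc 1 Q, ((2 * K : ℝ) / (#(auxPrimes K) : ℝ) *
            ∑ ℓ ∈ auxPrimes K, primeAPError x (q * ℓ) + Real.log x) :=
          Finset.sum_le_sum step1
      _ = _ := by
          rw [Finset.sum_add_distrib, ← Finset.mul_sum, Finset.sum_const, nsmul_eq_mul,
            Nat.card_Icc, Nat.add_sub_cancel]
  -- step 3: the double sum as a weighted sum over r = qℓ, weights ≤ B, support ⊆ liftedModuli
  have himg : ((Icc 1 Q) ×ˢ auxPrimes K).image (fun p : ℕ × ℕ => p.1 * p.2) ⊆ liftedModuli Q K := by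
    intro r hr
    rw [Finset.mem_image] at hr
    obtain ⟨⟨q, ℓ⟩, hqℓ, rfl⟩ := hr
    rw [Finset.mem_product] at hqℓ
    obtain ⟨hq, hℓ⟩ := hqℓ
    rw [Finset.mem_Icc] at hq
    have hb := hbd ℓ hℓ
    rw [mem_liftedModuli]
    refine ⟨⟨Nat.one_le_iff_ne_zero.mpr (mul_ne_zero (by omega) (by omega)), ?_⟩, ℓ, hℓ,
      dvd_mul_left ℓ q⟩
    calc q * ℓ ≤ Q * (2 * K) := Nat.mul_le_mul hq.2 hb.2
      _ = 2 * Q * K := by ring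
  have hfib : ∀ r ∈ ((Icc 1 Q) ×ˢ auxPrimes K).image (fun p : ℕ × ℕ => p.1 * p.2),
      (#(((Icc 1 Q) ×ˢ auxPrimes K).filter (fun p : ℕ × ℕ => p.1 * p.2 = r)) : ℝ) ≤ B := by
    intro r hr
    refine le_trans ?_ (hB r (himg hr))
    exact_mod_cast Finset.card_le_card_of_injOn (fun p : ℕ × ℕ => p.2)
      (fun p hp => by
        rw [Finset.mem_coe, Finset.mem_filter, Finset.mem_product] at hp
        rw [Finset.mem_coe, Finset.mem_filter]
        exact ⟨hp.1.2, hp.2 ▸ dvd_mul_left _ _⟩)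
      (fun p₁ hp₁ p₂ hp₂ h2 => by
        rw [Finset.mem_coe, Finset.mem_filter, Finset.mem_product] at hp₁ hp₂
        have hℓ0 : p₁.2 ≠ 0 := (hprime _ hp₁.1.2).ne_zero
        have h1 : p₁.1 * p₁.2 = p₂.1 * p₁.2 := by
          rw [hp₁.2, ← hp₂.2]; simp only at h2; rw [h2]
        exact Prod.ext (Nat.eq_of_mul_eq_mul_right (Nat.pos_of_ne_zero hℓ0) h1) h2)
  have step3 : ∑ q ∈ Icc 1 Q, ∑ ℓ ∈ auxPrimes K, primeAPError x (q * ℓ) ≤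
      B * ∑ r ∈ liftedModuli Q K, primeAPError x r := by
    rw [← Finset.sum_product (s := Icc 1 Q) (t := auxPrimes K)
        (f := fun p => primeAPError x (p.1 * p.2)),
      Finset.sum_comp (fun r => primeAPError x r) (fun p : ℕ × ℕ => p.1 * p.2)]
    calc ∑ r ∈ ((Icc 1 Q) ×ˢ auxPrimes K).image (fun p : ℕ × ℕ => p.1 * p.2),
          #(((Icc 1 Q) ×ˢ auxPrimes K).filter (fun p : ℕ × ℕ => p.1 * p.2 = r)) • primeAPError x r
        ≤ ∑ r ∈ ((Icc 1 Q) ×ˢ auxPrimes K).image (fun p : ℕ × ℕ => p.1 * p.2),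
            B * primeAPError x r := by
          refine Finset.sum_le_sum fun r hr => ?_
          rw [nsmul_eq_mul]
          exact mul_le_mul_of_nonneg_right (hfib r hr) (hE0 r)
      _ ≤ ∑ r ∈ liftedModuli Q K, B * primeAPError x r := by
          refine Finset.sum_le_sum_of_subset_of_nonneg himg fun r hr _ => ?_
          have : (0 : ℝ) ≤ B := le_trans (Nat.cast_nonneg _) (hB r hr)
          exact mul_nonneg this (hE0 r)
      _ = B * ∑ r ∈ liftedModuli Q K, primeAPError x r := by rw [Finset.mul_sum]
  -- assemble
  have hcoef : 0 ≤ (2 * K : ℝ) / (#(auxPrimes K) : ℝ) := by positivity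
  calc ∑ q ∈ Icc 1 Q, primeAPError x q
      ≤ (2 * K : ℝ) / (#(auxPrimes K) : ℝ) *
          ∑ q ∈ Icc 1 Q, ∑ ℓ ∈ auxPrimes K, primeAPError x (q * ℓ) + Q * Real.log x := step2
    _ ≤ (2 * K : ℝ) / (#(auxPrimes K) : ℝ) * (B * ∑ r ∈ liftedModuli Q K, primeAPError x r)
          + Q * Real.log x := by gcongr
    _ = (2 * K : ℝ) / (#(auxPrimes K) : ℝ) * B * ∑ r ∈ liftedModuli Q K, primeAPError x r
          + Q * Real.log x := by ring

/-- Moduli `q ≤ x^{θ−ε}` possessing a divisor `k` with `x^κ < k ≤ 2x^κ`. -/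
noncomputable def factorableModuli (x θ ε κ : ℝ) : Finset ℕ :=
  (Icc 1 ⌊x ^ (θ - ε)⌋₊).filter fun q => ∃ k : ℕ, x ^ κ < (k : ℝ) ∧ (k : ℝ) ≤ 2 * x ^ κ ∧ k ∣ q

/-- `PrimesHaveLevelFactorable θ κ`: the EH/BV shape at level `x^{θ−ε}` RESTRICTED to moduli with a
divisor in `(x^κ, 2x^κ]`. -/
def PrimesHaveLevelFactorable (θ κ : ℝ) : Prop :=
  ∀ A : ℝ, 0 < A → ∀ ε : ℝ, 0 < ε →
    (fun x : ℝ => ∑ q ∈ factorableModuli x θ ε κ, primeAPError x q) =O[atTop]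
      fun x : ℝ => x / Real.log x ^ A

/-- A level of distribution trivially gives the factorable form (sub-sum of nonnegative terms). -/
theorem primesHaveLevelFactorable_of_primesHaveLevel {θ : ℝ} (κ : ℝ) (h : PrimesHaveLevel θ) :
    PrimesHaveLevelFactorable θ κ := by
  intro A hA ε hε
  refine Asymptotics.IsBigO.trans (Asymptotics.IsBigO.of_bound 1 ?_) (h A hA ε hε)
  filter_upwards with x
  have h0 : ∀ q, 0 ≤ primeAPError x q := fun q => primeAPError_nonneg x q
  rw [one_mul, Real.norm_eq_abs, Real.norm_eq_abs, abs_of_nonneg (Finset.sum_nonneg fun q _ => h0 q),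
    abs_of_nonneg (Finset.sum_nonneg fun q _ => h0 q)]
  exact Finset.sum_le_sum_of_subset_of_nonneg (Finset.filter_subset _ _) fun q _ _ => h0 q

/-- LEVEL LIFTING, factorable form (PROVED): EH at level `θ+κ` for moduli carrying a divisor in
`(x^κ, 2x^κ]` gives EH at level `θ` for ALL moduli (`0 ≤ θ`, `0 < κ`, `θ + κ ≤ 1`). Inputs: the finite
averaged lifting `sum_primeAPError_le_lift`, the prime number theorem in the form
`DFI_card_primes_Ioc_ge` (`#{K < p ≤ 2K} ≥ K/(2 log K)`), and `(log x)^{A+1} = o(x^ε)`. -/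
theorem primesHaveLevel_of_factorable {θ κ : ℝ} (hθ : 0 ≤ θ) (hκ : 0 < κ) (hθκ : θ + κ ≤ 1)
    (h : PrimesHaveLevelFactorable (θ + κ) κ) : PrimesHaveLevel θ := by
  intro A hA ε hε
  obtain ⟨L₀, hL₀⟩ := Literature.NumberTheory.LFunctions.DFI_card_primes_Ioc_ge
  have hε2 : 0 < ε / 2 := by linarith
  have hκ1 : κ ≤ 1 := by linarith
  set F : ℝ → ℝ := fun x => ∑ r ∈ factorableModuli x (θ + κ) (ε / 2) κ, primeAPError x r with hF
  have hFO : F =O[atTop] fun x : ℝ => x / Real.log x ^ (A + 1) := by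
    rw [hF]; exact h (A + 1) (by linarith) (ε / 2) hε2
  have herr := rpow_mul_log_le_div_eventually hε A
  have ev1 : ∀ᶠ x : ℝ in atTop, (L₀ : ℝ) + 2 ≤ x ^ κ :=
    (tendsto_rpow_atTop hκ).eventually_ge_atTop _
  have ev2 : ∀ᶠ x : ℝ in atTop, Real.log 2 ≤ κ / 2 * Real.log x :=
    (Real.tendsto_log_atTop.const_mul_atTop (by linarith : 0 < κ / 2)).eventually_ge_atTop _
  have ev3 : ∀ᶠ x : ℝ in atTop, (2 : ℝ) ≤ x ^ (ε / 2) :=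
    (tendsto_rpow_atTop hε2).eventually_ge_atTop _
  -- the pointwise bound, eventually
  have hpt : ∀ᶠ x : ℝ in atTop, ∑ q ∈ Icc 1 ⌊x ^ (θ - ε)⌋₊, primeAPError x q ≤
      16 / κ * (Real.log x * F x) + x / Real.log x ^ A := by
    filter_upwards [ev1, ev2, ev3, herr, eventually_ge_atTop (2 : ℝ)] with x hx1 hx2 hx3 hxerr hx
    set Q : ℕ := ⌊x ^ (θ - ε)⌋₊ with hQ
    set K : ℕ := ⌊x ^ κ⌋₊ with hK
    have hx0 : 0 < x := by linarith
    have hx1' : (1 : ℝ) ≤ x := by linarith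
    have hlogx : 0 < Real.log x := Real.log_pos (by linarith)
    have hxκ : (K : ℝ) ≤ x ^ κ := Nat.floor_le (Real.rpow_nonneg hx0.le κ)
    have hxκ' : x ^ κ < (K : ℝ) + 1 := Nat.lt_floor_add_one _
    have hL0 : (0 : ℝ) ≤ L₀ := Nat.cast_nonneg _
    have hKL : L₀ ≤ K := by
      have : (L₀ : ℝ) < K := by linarith
      exact_mod_cast this.le
    have hK1 : (1 : ℝ) < K := by linarith
    have hK1n : 1 < K := by exact_mod_cast hK1
    have hlogK : 0 < Real.log K := Real.log_pos hK1
    have hP : (K : ℝ) / (2 * Real.log K) ≤ (#(auxPrimes K) : ℝ) := hL₀ K hKL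
    have hPpos' : (0 : ℝ) < (#(auxPrimes K) : ℝ) := lt_of_lt_of_le (by positivity) hP
    have hPpos : 0 < #(auxPrimes K) := by exact_mod_cast hPpos'
    -- log K ≥ (κ/2) log x
    have hKhalf : x ^ κ / 2 ≤ K := by linarith
    have hlogK' : κ / 2 * Real.log x ≤ Real.log K := by
      have h1 : Real.log (x ^ κ / 2) ≤ Real.log K := Real.log_le_log (by positivity) hKhalf
      rw [Real.log_div (by positivity) (by norm_num), Real.log_rpow hx0] at h1
      linarith
    -- log K ≤ log x
    have hKx : (K : ℝ) ≤ x := hxκ.trans (by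
      calc x ^ κ ≤ x ^ (1 : ℝ) := Real.rpow_le_rpow_of_exponent_le hx1' hκ1
        _ = x := Real.rpow_one x)
    have hlogKx : Real.log K ≤ Real.log x := Real.log_le_log (by linarith) hKx
    -- coefficient 2K/#P ≤ 4 log x
    have hcoef : (2 * K : ℝ) / (#(auxPrimes K) : ℝ) ≤ 4 * Real.log x := by
      rw [div_le_iff₀ hPpos']
      have h1 : (K : ℝ) ≤ (#(auxPrimes K) : ℝ) * (2 * Real.log K) := by
        have := hP; rw [div_le_iff₀ (by positivity)] at this; linarith
      nlinarith [hlogKx, h1, hPpos'.le, hlogK.le]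
    -- number of auxiliary prime divisors of a lifted modulus is ≤ 4/κ
    have hBbound : ∀ r ∈ liftedModuli Q K,
        (#((auxPrimes K).filter (fun ℓ => ℓ ∣ r)) : ℝ) ≤ 4 / κ := by
      intro r hr
      rw [mem_liftedModuli] at hr
      obtain ⟨⟨hr1, hr2⟩, -⟩ := hr
      have hDprime : ∀ ℓ ∈ (auxPrimes K).filter (fun ℓ => ℓ ∣ r), Prime ℓ := fun ℓ hℓ =>
        Nat.prime_iff.mp (mem_auxPrimes.mp (Finset.mem_filter.mp hℓ).1).2
      have hDdvd : ∀ ℓ ∈ (auxPrimes K).filter (fun ℓ => ℓ ∣ r), ℓ ∣ r := fun ℓ hℓ =>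
        (Finset.mem_filter.mp hℓ).2
      have hDge : ∀ ℓ ∈ (auxPrimes K).filter (fun ℓ => ℓ ∣ r), K ≤ ℓ := fun ℓ hℓ =>
        (mem_auxPrimes.mp (Finset.mem_filter.mp hℓ).1).1.1.le
      have hprod : ∏ ℓ ∈ (auxPrimes K).filter (fun ℓ => ℓ ∣ r), ℓ ∣ r :=
        Finset.prod_primes_dvd r hDprime hDdvd
      have hr0 : r ≠ 0 := by omega
      have hpow : K ^ #((auxPrimes K).filter (fun ℓ => ℓ ∣ r)) ≤ r :=
        (Finset.pow_card_le_prod _ (fun ℓ => ℓ) K hDge).trans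
          (Nat.le_of_dvd (Nat.pos_of_ne_zero hr0) hprod)
      have h1 : (#((auxPrimes K).filter (fun ℓ => ℓ ∣ r)) : ℝ) * Real.log K ≤ Real.log r := by
        rw [← Real.log_pow]
        exact Real.log_le_log (by positivity) (by exact_mod_cast hpow)
      have hr2' : (r : ℝ) ≤ 2 * x := by
        calc (r : ℝ) ≤ 2 * Q * K := by exact_mod_cast hr2
          _ ≤ 2 * x ^ (θ - ε) * x ^ κ :=
              mul_le_mul (mul_le_mul_of_nonneg_left (Nat.floor_le (Real.rpow_nonneg hx0.le _))
                (by norm_num)) hxκ (Nat.cast_nonneg _) (by positivity)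
          _ = 2 * x ^ (θ + κ - ε) := by
              rw [mul_assoc, ← Real.rpow_add hx0, show θ - ε + κ = θ + κ - ε by ring]
          _ ≤ 2 * x ^ (1 : ℝ) :=
              mul_le_mul_of_nonneg_left (Real.rpow_le_rpow_of_exponent_le hx1' (by linarith))
                (by norm_num)
          _ = 2 * x := by rw [Real.rpow_one]
      have h2 : Real.log r ≤ 2 * Real.log x := by
        have hlog2 : Real.log 2 ≤ Real.log x := Real.log_le_log two_pos hx
        calc Real.log r ≤ Real.log (2 * x) :=
              Real.log_le_log (by exact_mod_cast Nat.pos_of_ne_zero hr0) hr2'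
          _ = Real.log 2 + Real.log x := Real.log_mul (by norm_num) hx0.ne'
          _ ≤ 2 * Real.log x := by linarith
      have h3 : (#((auxPrimes K).filter (fun ℓ => ℓ ∣ r)) : ℝ) * (κ / 2 * Real.log x) ≤
          2 * Real.log x :=
        le_trans (mul_le_mul_of_nonneg_left hlogK' (Nat.cast_nonneg _)) (h1.trans h2)
      rw [le_div_iff₀ hκ]
      nlinarith [h3, hlogx]
    -- the finite lifting
    have hfin := sum_primeAPError_le_lift Q K hx1' hPpos hBbound
    -- lifted moduli are factorable moduli at level θ+κ with slack ε/2
    have hsub : liftedModuli Q K ⊆ factorableModuli x (θ + κ) (ε / 2) κ := by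
      intro r hr
      rw [mem_liftedModuli] at hr
      obtain ⟨⟨hr1, hr2⟩, ℓ, hℓ, hℓr⟩ := hr
      have hb := (mem_auxPrimes.mp hℓ).1
      rw [factorableModuli, Finset.mem_filter, Finset.mem_Icc]
      refine ⟨⟨hr1, ?_⟩, ℓ, ?_, ?_, hℓr⟩
      · refine Nat.le_floor ?_
        calc (r : ℝ) ≤ 2 * Q * K := by exact_mod_cast hr2
          _ ≤ 2 * x ^ (θ - ε) * x ^ κ :=
              mul_le_mul (mul_le_mul_of_nonneg_left (Nat.floor_le (Real.rpow_nonneg hx0.le _))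
                (by norm_num)) hxκ (Nat.cast_nonneg _) (by positivity)
          _ = x ^ (θ + κ - ε) * 2 := by
              rw [mul_assoc, ← Real.rpow_add hx0, show θ - ε + κ = θ + κ - ε by ring, mul_comm]
          _ ≤ x ^ (θ + κ - ε) * x ^ (ε / 2) :=
              mul_le_mul_of_nonneg_left hx3 (Real.rpow_nonneg hx0.le _)
          _ = x ^ (θ + κ - ε / 2) := by
              rw [← Real.rpow_add hx0, show θ + κ - ε + ε / 2 = θ + κ - ε / 2 by ring]
      · calc x ^ κ < (K : ℝ) + 1 := hxκ'
          _ ≤ ℓ := by exact_mod_cast hb.1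
      · calc (ℓ : ℝ) ≤ 2 * K := by exact_mod_cast hb.2
          _ ≤ 2 * x ^ κ := by linarith
    have hF0 : 0 ≤ F x := by
      simp only [hF]; exact Finset.sum_nonneg fun r _ => primeAPError_nonneg x r
    have hFx : ∑ r ∈ liftedModuli Q K, primeAPError x r ≤ F x := by
      simp only [hF]
      exact Finset.sum_le_sum_of_subset_of_nonneg hsub fun r _ _ => primeAPError_nonneg x r
    have hS0 : 0 ≤ ∑ r ∈ liftedModuli Q K, primeAPError x r :=
      Finset.sum_nonneg fun r _ => primeAPError_nonneg x r
    have herrQ : (Q : ℝ) * Real.log x ≤ x / Real.log x ^ A := by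
      calc (Q : ℝ) * Real.log x ≤ x ^ (θ - ε) * Real.log x :=
            mul_le_mul_of_nonneg_right (Nat.floor_le (Real.rpow_nonneg hx0.le _)) hlogx.le
        _ ≤ x ^ (1 - ε) * Real.log x :=
            mul_le_mul_of_nonneg_right (Real.rpow_le_rpow_of_exponent_le hx1' (by linarith)) hlogx.le
        _ ≤ _ := hxerr
    have hcoef0 : 0 ≤ (2 * K : ℝ) / (#(auxPrimes K) : ℝ) := by positivity
    calc ∑ q ∈ Icc 1 Q, primeAPError x q
        ≤ (2 * K : ℝ) / (#(auxPrimes K) : ℝ) * (4 / κ) * ∑ r ∈ liftedModuli Q K, primeAPError x r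
            + Q * Real.log x := hfin
      _ ≤ (4 * Real.log x) * (4 / κ) * F x + x / Real.log x ^ A := by
          refine add_le_add ?_ herrQ
          calc (2 * K : ℝ) / (#(auxPrimes K) : ℝ) * (4 / κ) * ∑ r ∈ liftedModuli Q K, primeAPError x r
              ≤ (2 * K : ℝ) / (#(auxPrimes K) : ℝ) * (4 / κ) * F x :=
                mul_le_mul_of_nonneg_left hFx (by positivity)
            _ ≤ (4 * Real.log x) * (4 / κ) * F x :=
                mul_le_mul_of_nonneg_right (mul_le_mul_of_nonneg_right hcoef (by positivity)) hF0
      _ = 16 / κ * (Real.log x * F x) + x / Real.log x ^ A := by ring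
  -- BigO conclusion
  have hlogF : (fun x : ℝ => Real.log x * F x) =O[atTop] fun x : ℝ => x / Real.log x ^ A := by
    have h1 : (fun x : ℝ => Real.log x * F x) =O[atTop]
        fun x : ℝ => Real.log x * (x / Real.log x ^ (A + 1)) :=
      (Asymptotics.isBigO_refl (fun x : ℝ => Real.log x) atTop).mul hFO
    refine h1.trans (Asymptotics.IsBigO.of_bound 1 ?_)
    filter_upwards [eventually_gt_atTop (1 : ℝ)] with x hx
    have hlog : 0 < Real.log x := Real.log_pos hx
    have hx0 : 0 < x := by linarith
    have heq : Real.log x * (x / Real.log x ^ (A + 1)) = x / Real.log x ^ A := by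
      rw [Real.rpow_add_one hlog.ne']
      field_simp
    rw [heq, one_mul]
  have hG : (fun x : ℝ => 16 / κ * (Real.log x * F x) + x / Real.log x ^ A) =O[atTop]
      fun x : ℝ => x / Real.log x ^ A :=
    (hlogF.const_mul_left _).add (Asymptotics.isBigO_refl _ _)
  refine Asymptotics.IsBigO.trans (Asymptotics.IsBigO.of_bound 1 ?_) hG
  filter_upwards [hpt, eventually_gt_atTop (1 : ℝ)] with x hx hx1
  have h0 : 0 ≤ ∑ q ∈ Icc 1 ⌊x ^ (θ - ε)⌋₊, primeAPError x q :=
    Finset.sum_nonneg fun q _ => primeAPError_nonneg x q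
  have hF0 : 0 ≤ F x := by
    simp only [hF]; exact Finset.sum_nonneg fun r _ => primeAPError_nonneg x r
  have hlog0 : 0 ≤ Real.log x := Real.log_nonneg hx1.le
  have hd0 : 0 ≤ x / Real.log x ^ A := div_nonneg (by linarith) (Real.rpow_nonneg hlog0 _)
  have hG0 : 0 ≤ 16 / κ * (Real.log x * F x) + x / Real.log x ^ A :=
    add_nonneg (mul_nonneg (by positivity) (mul_nonneg hlog0 hF0)) hd0
  rw [one_mul, Real.norm_eq_abs, Real.norm_eq_abs, abs_of_nonneg h0, abs_of_nonneg hG0]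
  exact hx

/-- `EHFactorable`: EH for moduli carrying a divisor of every prescribed power size. -/
def EHFactorable : Prop :=
  ∀ θ : ℝ, θ < 1 → ∀ κ : ℝ, 0 < κ → κ < 1 → PrimesHaveLevelFactorable θ κ

/-- THE FACTORABLE EQUIVALENCE (PROVED): the Elliott–Halberstam conjecture is equivalent to its
restriction to moduli carrying a divisor in `(x^κ, 2x^κ]`, for all `κ`. -/
theorem elliottHalberstam_iff_ehFactorable :
    Literature.NumberTheory.Sieve.LevelOfDistribution.ElliottHalberstam ↔ EHFactorable := by
  constructor
  · intro h θ hθ κ _ _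
    exact primesHaveLevelFactorable_of_primesHaveLevel κ (h θ hθ)
  · intro h θ hθ
    set θ' : ℝ := max θ 0 with hθ'
    have hθ'1 : θ' < 1 := max_lt hθ one_pos
    have hθ'0 : 0 ≤ θ' := le_max_right _ _
    have hκ : 0 < (1 - θ') / 2 := by linarith
    have h1 : PrimesHaveLevelFactorable (θ' + (1 - θ') / 2) ((1 - θ') / 2) :=
      h (θ' + (1 - θ') / 2) (by linarith) ((1 - θ') / 2) hκ (by linarith)
    exact (primesHaveLevel_of_factorable hθ'0 hκ (by linarith) h1).mono (le_max_left _ _)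

end Summit.Parity.GeneralizedHardyLittlewood.Theorems.ElliottHalberstam.Lifting
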